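import Literature.NumberTheory.EllipticCurves.KellerYin2024.AnticyclotomicLocalEulerFactors
import Literature.NumberTheory.GaloisRepresentations.AbsGaloisOuterConj
import Literature.NumberTheory.GaloisRepresentations.DecompositionGroupOfCompletion
import Literature.NumberTheory.GaloisRepresentations.IntegralGaloisActionProofs
import Literature.NumberTheory.EllipticCurves.ArtinFormalismQuadraticLocalProofs
import Literature.NumberTheory.NumberFields.AdicCompletionIntegersPadicIntOfDegreeOne
import HarnessLib

/-!
# The anticyclotomic local `λ`-invariants at CONJUGATE places (`[Γ : Γ_{w̄}] = [Γ : Γ_w]`,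
# `λ(𝒫_{w̄}(θ)) = λ(𝒫_w(θ))`, `λ(𝒫_{w̄}(f_E)) = λ(𝒫_w(f_E))`) — proved reading lemmas

`Proofs`-type file (THEOREMS ONLY: no definition, no named fact, no instance) in topic
`NumberTheory/EllipticCurves`, paper namespace `KellerYin2024`, companion of
`AnticyclotomicLocalEulerFactors.lean` (DEFINITIONS `numPlacesAbove κ w = [Γ : Γ_w]`,
`charLocalLambda S κ θ w = λ(𝒫_w(θ))`, `curveLocalLambda κ W w = λ(𝒫_w(f))`).

PRINT. Castella–Grossi–Lee–Skinner 2022, proof of Thm. 2.2.2 (cor:Kriz; held text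
paper:arxiv-2008.02571 p. 12 L104–113): "the involution of `Λ` given by `γ ↦ γ⁻¹` … preserves
`λ`-invariants, and so `λ(𝒫_w(θ)²) = λ(𝒫_w(θ)) + λ(𝒫_{w̄}(θ))`, using that complex conjugation act as
inversion on `Γ`. For the term `𝓔_{φ,ψ}` … where `w` runs over all divisors, not just the one
dividing `𝔑`", leading to (eq:Euler-comp) `Σ_{w∈S}{λ(𝒫_w(φ)) + λ(𝒫_w(ψ)) − λ(𝒫_w(E))}`; the module
docstring of `AnticyclotomicLocalEulerFactors.lean` records the same remark ("Both invariants are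
unchanged by `γ ↦ γ⁻¹`").  PROVED HERE, in the tree's closed-form currency, for an ANTICYCLOTOMIC
`ℤ_p`-extension `κ` (`ZpExtension.IsAnticyclotomic`) of a number field `K` Galois over `ℚ`
(intended: imaginary quadratic) and `Gal(K/ℚ)`-conjugate finite places (for `K` quadratic: two
places above the same rational prime `ℓ`):

* §1 (any Galois `M/F`): the outer action `θ_τ` of `τ ∈ Γ_F` on `Γ_M` (`absGaloisOuterConj`,
  `GaloisRepresentations/AbsGaloisOuterConj.lean`) carries decomposition groups of primes of
  `\bar ℤ_M` to decomposition groups (`absGaloisOuterConj_mem_decompositionSubgroup_iff`) and the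
  tree's `D_w = GreenbergSelmer.decomp w` onto a `Γ_M`-conjugate of `D_{τ̄ • w}`
  (`exists_decomp_smul_eq_conj_map`); so `f(D_{τ̄ • w}) = f(D_w)` for every homomorphism `f` to an
  ABELIAN group fixed or inverted pointwise by `θ_τ` (`map_decomp_smul_eq_of_apply_absGaloisOuterConj`).
* §2: an anticyclotomic `κ` is inverted by `θ_τ` for `τ ∉ res(Γ_K)` and fixed otherwise, whence
  `numPlacesAbove κ (g • w) = numPlacesAbove κ w` for `g ∈ Gal(K/ℚ)`
  (`IsAnticyclotomic.numPlacesAbove_algEquiv_smul`) and the two-place forms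
  `IsAnticyclotomic.numPlacesAbove_eq_of_under_eq` / `…_of_natCast_mem` (`_of_finrank_eq_two`).
* §3: for a character `θ : Γ_K → GL₁(𝒪)` FIXED by `θ_τ` (`θ (θ_τ σ) = θ σ`; e.g. a restriction from
  `Γ_ℚ`, `comp_absGaloisRestrict_apply_absGaloisOuterConj`), `FrobActsAsNormAt S θ` and
  `charLocalLambda S κ θ` agree at `w` and `τ̄ • w` (`frobActsAsNormAt_smul_iff_of_apply_absGaloisOuterConj`,
  `IsAnticyclotomic.charLocalLambda_smul_of_apply_absGaloisOuterConj`, `…_eq_of_under_eq`,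
  `…_eq_of_natCast_mem`) — via the tree's `FramedGaloisRep.isUnramifiedAt_outerConj_iff`,
  `hasFrobCharpolyAt_outerConj_iff`, `HeightOneSpectrum.absNorm_algEquiv_smul`.
* §4 (`E/ℚ`, `K` quadratic): `GreenbergVatsal2000.eulerFactorModP (W.baseChange K) p` and
  `curveLocalLambda κ (W.baseChange K)` agree at two places above the same `ℓ`
  (`eulerFactorModP_baseChange_eq_of_natCast_mem`,
  `IsAnticyclotomic.curveLocalLambda_baseChange_eq_of_natCast_mem`), by the split case
  `L_w(E_K) = L_ℓ(E)` of the tree's `WeierstrassCurve.localPolynomialAt_baseChange_quadratic`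
  (Ireland–Rosen Prop. 20.5.4(b)) when `w ≠ w'`.

NOT here: the involution on `Λ`-elements themselves (no consumer reads `Λ`-elements); that the
residual characters `θsub, θquot` of `IsResidualPairOver (W.baseChange K) p θsub θquot` are fixed by
the outer action (§3 takes it as a hypothesis).  No summit statement, no case of BSD, no crux or
stub is proved by this file: it is a reading lemma for the (eq:Euler-comp) step of the
CGLS-2.2.2-shaped named facts `KellerYin2024.thm222_anacong_goodLattice_*`, whose conclusions sum
`curveLocalLambda` / `charLocalLambda` over ALL places `w ∈ Sf` above `N_E`.

## References
* [CastellaGrossiLeeSkinner2022] Invent. Math. 227 (2022), Thm. 2.2.1 (`𝓔_{φ,ψ}`, one `w ∣ 𝔑` per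
  `ℓ`) and proof of Thm. 2.2.2 (held text paper:arxiv-2008.02571 p. 12 L95–121).
* [KellerYin2024] arXiv:2402.12781v2, Lemma 1.0.1 (TeX L388), Lemma 1.1.1 (L455–462), Thm. 2.2.2.
* [Brink2007] Math. Comp. 76 (2007), §II Prop. 1 (`K^anti/ℚ` is pro-dihedral).
* [NeukirchANT1999] Ch. I §9 (9.1)–(9.5); Ch. II §9 (9.6).  [CasselsFrohlichANT1967] Ch. VII §1.1,
  Prop. 1.2 (ii).  [IrelandRosen1990] Prop. 20.5.4(b).
-/

noncomputable section

open scoped Classical Pointwise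
open NumberField IsDedekindDomain Field Polynomial
open Literature.NumberTheory.EllipticCurves Literature.NumberTheory.EllipticCurves.GreenbergSelmer
open Literature.NumberTheory.GaloisRepresentations

namespace Literature.NumberTheory.EllipticCurves.KellerYin2024

/-! ## §1 Decomposition groups along the outer action `θ_τ` of `Γ_F` on `Γ_K` -/
section OuterConj

variable {F M : Type*} [Field F] [Field M] [Algebra F M] [IsGalois F M] [CharZero M]

/-- **`θ_τ(D_𝔔) = D_{τ ⋆ 𝔔}`**, membership form: `θ_τ σ` lies in the decomposition group of
`τ ⋆ 𝔔` iff `σ` lies in that of `𝔔` (`res⁻¹(D_{ι⁻¹ 𝔔}) = D_𝔔` and `D_{τ • 𝔓} = τ D_𝔓 τ⁻¹`; the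
decomposition-group twin of the tree's `absGaloisOuterConj_mem_inertia_iff`).
[cite: NeukirchANT1999, Ch. I §9 (9.1)–(9.5) (conjugate primes, conjugate decomposition groups)] -/
theorem absGaloisOuterConj_mem_decompositionSubgroup_iff (τ : absoluteGaloisGroup F)
    (𝔔 : Ideal (absIntegers (𝓞 M) M)) (σ : absoluteGaloisGroup M) :
    absGaloisOuterConj F M τ σ ∈ (outerConjIdeal τ 𝔔).decompositionSubgroup (absoluteGaloisGroup M) ↔
      σ ∈ 𝔔.decompositionSubgroup (absoluteGaloisGroup M) := by
  rw [← comap_decompositionSubgroup_comap_absIntegersMap F M (outerConjIdeal τ 𝔔),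
    ← comap_decompositionSubgroup_comap_absIntegersMap F M 𝔔, Subgroup.mem_comap, Subgroup.mem_comap]
  change absGaloisRestrict F M (absGaloisOuterConj F M τ σ) ∈ _ ↔ absGaloisRestrict F M σ ∈ _
  rw [comap_outerConjIdeal, absGaloisRestrict_absGaloisOuterConj, Ideal.decompositionSubgroup_smul,
    Subgroup.mem_pointwise_smul_iff_inv_smul_mem, MulAut.smul_def, MulAut.conj_inv_apply]
  have h : τ⁻¹ * (τ * absGaloisRestrict F M σ * τ⁻¹) * τ = absGaloisRestrict F M σ := by group
  rw [h]

/-- **`θ_τ(D_𝔔) = D_{τ ⋆ 𝔔}`** as subgroups of `Γ_M`.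
[cite: NeukirchANT1999, Ch. I §9 (9.1)–(9.5)] -/
theorem map_absGaloisOuterConj_decompositionSubgroup (τ : absoluteGaloisGroup F)
    (𝔔 : Ideal (absIntegers (𝓞 M) M)) :
    (𝔔.decompositionSubgroup (absoluteGaloisGroup M)).map (absGaloisOuterConj F M τ).toMonoidHom =
      (outerConjIdeal τ 𝔔).decompositionSubgroup (absoluteGaloisGroup M) := by
  refine le_antisymm (fun σ' hσ' ↦ ?_) (fun σ' hσ' ↦ ?_)
  · obtain ⟨σ, hσ, rfl⟩ := Subgroup.mem_map.1 hσ'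
    exact (absGaloisOuterConj_mem_decompositionSubgroup_iff τ 𝔔 σ).2 hσ
  · refine Subgroup.mem_map.2
      ⟨absGaloisOuterConj F M τ⁻¹ σ', ?_, absGaloisOuterConj_apply_inv_apply F M τ σ'⟩
    rw [← absGaloisOuterConj_mem_decompositionSubgroup_iff τ 𝔔, absGaloisOuterConj_apply_inv_apply]
    exact hσ'

variable [NumberField M]

/-- **`D_{τ̄ • w}` is a `Γ_M`-conjugate of `θ_τ(D_w)`** for the tree's `D_w = GreenbergSelmer.decomp w`
(decomposition group of `𝔓₀ = adicCompletionPrime M w`) and `τ̄ = absGaloisQuot F M τ ∈ Gal(M/F)`: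
`θ_τ(D_w) = D_{τ ⋆ 𝔓₀}`, and `τ ⋆ 𝔓₀`, like the chosen prime of `τ̄ • w`, lies above `τ̄ • w`, so
the two primes — and their decomposition groups — are `Γ_M`-conjugate (Neukirch I (9.1)).
[cite: NeukirchANT1999, Ch. I §9 Prop. (9.1) and (9.5)] [cite: CasselsFrohlichANT1967, Ch. VII §1.1] -/
theorem exists_decomp_smul_eq_conj_map (τ : absoluteGaloisGroup F) (w : HeightOneSpectrum (𝓞 M)) :
    ∃ σ₁ : absoluteGaloisGroup M,
      decomp (absGaloisQuot F M τ • w) =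
        MulAut.conj σ₁ • (decomp w).map (absGaloisOuterConj F M τ).toMonoidHom := by
  have hw : decomp w = (adicCompletionPrime M w).decompositionSubgroup (absoluteGaloisGroup M) :=
    (decompositionSubgroup_adicCompletionPrime_eq_range M w).symm
  have hw' : decomp (absGaloisQuot F M τ • w) =
      (adicCompletionPrime M (absGaloisQuot F M τ • w)).decompositionSubgroup (absoluteGaloisGroup M) :=
    (decompositionSubgroup_adicCompletionPrime_eq_range M _).symm
  obtain ⟨σ₁, hσ₁⟩ := HeightOneSpectrum.exists_smul_eq_of_mem_primesAbove_holds
    (outerConjIdeal_mem_primesAbove (adicCompletionPrime_mem_primesAbove M w) τ)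
    (adicCompletionPrime_mem_primesAbove M (absGaloisQuot F M τ • w))
  refine ⟨σ₁, ?_⟩
  rw [hw', hw, map_absGaloisOuterConj_decompositionSubgroup, ← hσ₁, Ideal.decompositionSubgroup_smul]

/-- **`f(D_{τ̄ • w}) = f(D_w)` for a homomorphism `f : Γ_M → A` to an abelian group which `θ_τ`
fixes or inverts pointwise** (`f (θ_τ σ) = f σ` or `= (f σ)⁻¹`): the image of a decomposition
group in an abelian group does not see `Γ_M`-conjugation, and a subgroup is stable under
inversion — the shape in which "complex conjugation acts as inversion on `Γ`" enters CGLS 2.2.2.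
[cite: CastellaGrossiLeeSkinner2022, proof of Thm. 2.2.2 ("complex conjugation act as inversion on Γ"; held text paper:arxiv-2008.02571 p. 12 L104–108)]
[cite: NeukirchANT1999, Ch. I §9 (9.1)–(9.5)] -/
theorem map_decomp_smul_eq_of_apply_absGaloisOuterConj {A : Type*} [CommGroup A]
    (f : absoluteGaloisGroup M →* A) (τ : absoluteGaloisGroup F)
    (hf : ∀ σ : absoluteGaloisGroup M,
      f (absGaloisOuterConj F M τ σ) = f σ ∨ f (absGaloisOuterConj F M τ σ) = (f σ)⁻¹)
    (w : HeightOneSpectrum (𝓞 M)) :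
    (decomp (absGaloisQuot F M τ • w)).map f = (decomp w).map f := by
  obtain ⟨σ₁, hσ₁⟩ := exists_decomp_smul_eq_conj_map τ w
  have hconj : ∀ x : absoluteGaloisGroup M, f (σ₁ * x * σ₁⁻¹) = f x := fun x ↦ by
    rw [map_mul, map_mul, map_inv, mul_inv_cancel_comm]
  rw [hσ₁]
  refine le_antisymm (fun a ha ↦ ?_) (fun a ha ↦ ?_)
  · obtain ⟨x, hx, rfl⟩ := Subgroup.mem_map.1 ha
    rw [Subgroup.mem_pointwise_smul_iff_inv_smul_mem, MulAut.smul_def, MulAut.conj_inv_apply] at hx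
    obtain ⟨y, hy, hyx⟩ := Subgroup.mem_map.1 hx
    have hfx : f x = f (absGaloisOuterConj F M τ y) := by
      change (absGaloisOuterConj F M τ) y = _ at hyx
      have hx' : x = σ₁ * (σ₁⁻¹ * x * σ₁) * σ₁⁻¹ := by group
      rw [hyx, ← hconj (σ₁⁻¹ * x * σ₁), ← hx']
    rcases hf y with h | h
    · exact Subgroup.mem_map.2 ⟨y, hy, by rw [← h, ← hfx]⟩
    · rw [hfx, h]
      exact inv_mem (Subgroup.mem_map.2 ⟨y, hy, rfl⟩)
  · obtain ⟨y, hy, rfl⟩ := Subgroup.mem_map.1 ha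
    have hmem : σ₁ * absGaloisOuterConj F M τ y * σ₁⁻¹ ∈
        MulAut.conj σ₁ • (decomp w).map (absGaloisOuterConj F M τ).toMonoidHom := by
      rw [Subgroup.mem_pointwise_smul_iff_inv_smul_mem, MulAut.smul_def, MulAut.conj_inv_apply]
      have hy' : σ₁⁻¹ * (σ₁ * absGaloisOuterConj F M τ y * σ₁⁻¹) * σ₁ = absGaloisOuterConj F M τ y := by
        group
      rw [hy']
      exact Subgroup.mem_map.2 ⟨y, hy, rfl⟩
    rcases hf y with h | h
    · exact Subgroup.mem_map.2 ⟨_, hmem, by rw [hconj, h]⟩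
    · rw [← inv_inv (f y), ← h, ← hconj, ← map_inv]
      exact Subgroup.mem_map.2 ⟨_, inv_mem hmem, rfl⟩

end OuterConj

/-! ## §2 `[Γ : Γ_{w̄}] = [Γ : Γ_w]` for an anticyclotomic `ℤ_p`-extension -/
section Anticyclotomic

variable {K : Type} [Field K] [NumberField K] {p : ℕ} [Fact p.Prime]

/-- An anticyclotomic `κ` is INVERTED by the outer action of `τ ∈ Γ_ℚ ∖ res(Γ_K)` (a lift of
complex conjugation): `κ(θ_τ σ) = κ(σ)⁻¹` (definition of `IsAnticyclotomic`, via
`res(θ_τ σ) = τ res(σ) τ⁻¹`). [cite: Brink2007, §II Prop. 1 (K^anti/ℚ is pro-dihedral)] -/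
theorem _root_.Literature.NumberTheory.EllipticCurves.ZpExtension.IsAnticyclotomic.apply_absGaloisOuterConj_of_not_mem
    [IsGalois ℚ K] {κ : ZpExtension K p} (hκ : κ.IsAnticyclotomic) {τ : absoluteGaloisGroup ℚ}
    (hτ : τ ∉ Set.range (absGaloisRestrict ℚ K)) (σ : absoluteGaloisGroup K) :
    κ (absGaloisOuterConj ℚ K τ σ) = (κ σ)⁻¹ :=
  hκ σ _ τ hτ (absGaloisRestrict_absGaloisOuterConj ℚ K τ σ)

/-- Any `κ : Γ_K → ℤ_p` is FIXED by the outer action of `τ ∈ res(Γ_K)` (`θ_τ` is inner there and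
`ℤ_p` is abelian). [folklore] -/
private theorem apply_absGaloisOuterConj_of_mem
    [IsGalois ℚ K] (κ : ZpExtension K p) {τ : absoluteGaloisGroup ℚ}
    (hτ : τ ∈ Set.range (absGaloisRestrict ℚ K)) (σ : absoluteGaloisGroup K) :
    κ (absGaloisOuterConj ℚ K τ σ) = κ σ := by
  obtain ⟨σ₀, rfl⟩ := hτ
  rw [absGaloisOuterConj_absGaloisRestrict_apply, map_mul, map_mul, map_inv, mul_inv_cancel_comm]

/-- **`κ(D_{g • w}) = κ(D_w)`** for an anticyclotomic `κ` of `K` Galois over `ℚ` and `g ∈ Gal(K/ℚ)`: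
lift `g` to `τ ∈ Γ_ℚ` (`absGaloisQuot_surjective`); `θ_τ` fixes `κ` if `τ ∈ res(Γ_K)` and inverts
it otherwise, so §1 applies (for `K` imaginary quadratic, `g = c`: `Γ_{w̄} = Γ_w` in `Gal(K_∞/K)`).
[cite: CastellaGrossiLeeSkinner2022, proof of Thm. 2.2.2 ("complex conjugation act as inversion on Γ"; held text paper:arxiv-2008.02571 p. 12 L104–108)]
[cite: Brink2007, §II Prop. 1] -/
theorem _root_.Literature.NumberTheory.EllipticCurves.ZpExtension.IsAnticyclotomic.map_decomp_algEquiv_smul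
    [IsGalois ℚ K] {κ : ZpExtension K p} (hκ : κ.IsAnticyclotomic) (g : K ≃ₐ[ℚ] K)
    (w : HeightOneSpectrum (𝓞 K)) :
    (decomp (g • w)).map κ.toContinuousMonoidHom.toMonoidHom =
      (decomp w).map κ.toContinuousMonoidHom.toMonoidHom := by
  obtain ⟨τ, rfl⟩ := absGaloisQuot_surjective ℚ K g
  refine map_decomp_smul_eq_of_apply_absGaloisOuterConj _ τ (fun σ ↦ ?_) w
  by_cases hτ : τ ∈ Set.range (absGaloisRestrict ℚ K)
  · exact Or.inl (apply_absGaloisOuterConj_of_mem κ hτ σ)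
  · exact Or.inr (hκ.apply_absGaloisOuterConj_of_not_mem hτ σ)

/-- **`[Γ : Γ_{g • w}] = [Γ : Γ_w]`**: the number of places of the anticyclotomic tower above `w`
(`numPlacesAbove κ w`) is the same at `Gal(K/ℚ)`-conjugate places (KY Lemma 1.0.1 describes it
through the rational prime `ℓ` below `w` only).
[cite: KellerYin2024, Lemma 1.0.1 (arXiv:2402.12781v2 TeX L388) and Lemma 1.1.1 (L455–462)]
[cite: CastellaGrossiLeeSkinner2022, proof of Thm. 2.2.2 ("complex conjugation act as inversion on Γ")] -/
theorem _root_.Literature.NumberTheory.EllipticCurves.ZpExtension.IsAnticyclotomic.numPlacesAbove_algEquiv_smul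
    [IsGalois ℚ K] {κ : ZpExtension K p} (hκ : κ.IsAnticyclotomic) (g : K ≃ₐ[ℚ] K)
    (w : HeightOneSpectrum (𝓞 K)) :
    numPlacesAbove κ (g • w) = numPlacesAbove κ w := by
  rw [numPlacesAbove_eq, numPlacesAbove_eq, hκ.map_decomp_algEquiv_smul g w]

/-- **`[Γ : Γ_{w'}] = [Γ : Γ_w]` for two places of `K` above the same place of `ℚ`** (`K/ℚ` Galois,
`κ` anticyclotomic; `Gal(K/ℚ)` is transitive on such places, Cassels–Fröhlich VII Prop. 1.2 (ii)).
[cite: KellerYin2024, Lemma 1.0.1 (arXiv:2402.12781v2 TeX L388)] [cite: CasselsFrohlichANT1967, Ch. VII Prop. 1.2 (ii)] -/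
theorem _root_.Literature.NumberTheory.EllipticCurves.ZpExtension.IsAnticyclotomic.numPlacesAbove_eq_of_under_eq
    [IsGalois ℚ K] {κ : ZpExtension K p} (hκ : κ.IsAnticyclotomic) {w w' : HeightOneSpectrum (𝓞 K)}
    (h : w.under (𝓞 ℚ) = w'.under (𝓞 ℚ)) :
    numPlacesAbove κ w = numPlacesAbove κ w' := by
  obtain ⟨g, rfl⟩ := Automorphic.HeightOneSpectrum.exists_algEquiv_smul_eq (F := ℚ) (E := K) h
  exact (hκ.numPlacesAbove_algEquiv_smul g w).symm

/-- **`[Γ : Γ_{w'}] = [Γ : Γ_w]` for two places containing the same rational prime `ℓ`** (`K/ℚ`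
Galois, `κ` anticyclotomic) — the form read by (eq:Euler-comp), where `w, w̄ ∣ ℓ ∣ N`.
[cite: KellerYin2024, Lemma 1.0.1 (arXiv:2402.12781v2 TeX L388)] -/
theorem _root_.Literature.NumberTheory.EllipticCurves.ZpExtension.IsAnticyclotomic.numPlacesAbove_eq_of_natCast_mem
    [IsGalois ℚ K] {κ : ZpExtension K p} (hκ : κ.IsAnticyclotomic) {ℓ : ℕ} (hℓ : ℓ.Prime)
    {w w' : HeightOneSpectrum (𝓞 K)} (hw : ((ℓ : ℕ) : 𝓞 K) ∈ w.asIdeal)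
    (hw' : ((ℓ : ℕ) : 𝓞 K) ∈ w'.asIdeal) :
    numPlacesAbove κ w = numPlacesAbove κ w' :=
  haveI : Fact ℓ.Prime := ⟨hℓ⟩
  hκ.numPlacesAbove_eq_of_under_eq (NumberFields.under_eq_under_of_natCast_mem K hw hw')

/-- `numPlacesAbove_eq_of_natCast_mem` with the Galois hypothesis supplied by `[K : ℚ] = 2`
(Mathlib `IsQuadraticExtension.isGalois`) — the binders of the consumers (`IsImaginaryQuadratic`).
[cite: KellerYin2024, Lemma 1.0.1 (arXiv:2402.12781v2 TeX L388)] -/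
theorem _root_.Literature.NumberTheory.EllipticCurves.ZpExtension.IsAnticyclotomic.numPlacesAbove_eq_of_natCast_mem_of_finrank_eq_two
    (hK : Module.finrank ℚ K = 2) {κ : ZpExtension K p} (hκ : κ.IsAnticyclotomic) {ℓ : ℕ}
    (hℓ : ℓ.Prime) {w w' : HeightOneSpectrum (𝓞 K)} (hw : ((ℓ : ℕ) : 𝓞 K) ∈ w.asIdeal)
    (hw' : ((ℓ : ℕ) : 𝓞 K) ∈ w'.asIdeal) :
    numPlacesAbove κ w = numPlacesAbove κ w' :=
  haveI : Algebra.IsQuadraticExtension ℚ K := ⟨hK⟩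
  hκ.numPlacesAbove_eq_of_natCast_mem hℓ hw hw'

end Anticyclotomic

/-! ## §3 `λ(𝒫_{w̄}(θ)) = λ(𝒫_w(θ))` for a character fixed by the outer action -/
section Character

variable {K : Type} [Field K] [NumberField K] {p : ℕ} [Fact p.Prime] (S : Set (PadicAlgCl p))

/-- **"`θ` unramified at `w` with `θ(Frob_w) ≡ Nw`" holds at `w` iff at `τ̄ • w`, for a character
`θ : Γ_K → GL₁(𝒪)` fixed by the outer action of `τ ∈ Γ_ℚ`**: `θ_τ` carries inertia groups and
arithmetic Frobenii above `w` onto those above `τ̄ • w` (`FramedGaloisRep.isUnramifiedAt_outerConj_iff`,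
`hasFrobCharpolyAt_outerConj_iff`), and `N(τ̄ • w) = Nw` (`HeightOneSpectrum.absNorm_algEquiv_smul`).
[cite: KellerYin2024, Lemma 1.1.1 (arXiv:2402.12781v2 TeX L455–462)]
[cite: NeukirchANT1999, Ch. I §9 (9.4)–(9.5)] -/
theorem frobActsAsNormAt_smul_iff_of_apply_absGaloisOuterConj [IsGalois ℚ K]
    (θ : FramedGaloisRep K (padicCoeffIntegers S) 1) {τ : absoluteGaloisGroup ℚ}
    (hθ : ∀ σ : absoluteGaloisGroup K, θ (absGaloisOuterConj ℚ K τ σ) = θ σ)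
    (w : HeightOneSpectrum (𝓞 K)) :
    FrobActsAsNormAt S θ (absGaloisQuot ℚ K τ • w) ↔ FrobActsAsNormAt S θ w := by
  have hθ' : θ.outerConj τ = θ := ContinuousMonoidHom.ext hθ
  unfold FrobActsAsNormAt
  rw [← FramedGaloisRep.isUnramifiedAt_outerConj_iff τ θ w, hθ',
    Automorphic.HeightOneSpectrum.absNorm_algEquiv_smul]
  refine and_congr Iff.rfl (exists_congr fun a ↦ and_congr ?_ Iff.rfl)
  rw [← FramedGaloisRep.hasFrobCharpolyAt_outerConj_iff τ θ w, hθ']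

/-- **`λ(𝒫_{τ̄ • w}(θ)) = λ(𝒫_w(θ))`** for an anticyclotomic `κ` and a character `θ` fixed by the outer
action of `τ ∈ Γ_ℚ` (§2 for the factor `[Γ : Γ_w]`, the previous lemma for the indicator).
[cite: KellerYin2024, Lemma 1.1.1 (arXiv:2402.12781v2 TeX L455–462)]
[cite: CastellaGrossiLeeSkinner2022, proof of Thm. 2.2.2 (eq:Euler-comp)] -/
theorem _root_.Literature.NumberTheory.EllipticCurves.ZpExtension.IsAnticyclotomic.charLocalLambda_smul_of_apply_absGaloisOuterConj
    [IsGalois ℚ K] {κ : ZpExtension K p} (hκ : κ.IsAnticyclotomic)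
    (θ : FramedGaloisRep K (padicCoeffIntegers S) 1) {τ : absoluteGaloisGroup ℚ}
    (hθ : ∀ σ : absoluteGaloisGroup K, θ (absGaloisOuterConj ℚ K τ σ) = θ σ)
    (w : HeightOneSpectrum (𝓞 K)) :
    charLocalLambda S κ θ (absGaloisQuot ℚ K τ • w) = charLocalLambda S κ θ w := by
  unfold charLocalLambda
  rw [hκ.numPlacesAbove_algEquiv_smul, frobActsAsNormAt_smul_iff_of_apply_absGaloisOuterConj S θ hθ w]

/-- **`λ(𝒫_{w'}(θ)) = λ(𝒫_w(θ))` for two places above the same place of `ℚ`**, for an anticyclotomic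
`κ` and a character `θ` fixed by the whole outer action of `Γ_ℚ` (e.g. a restriction from `Γ_ℚ`).
[cite: KellerYin2024, Lemma 1.1.1 (L455–462)] [cite: CastellaGrossiLeeSkinner2022, proof of Thm. 2.2.2 (eq:Euler-comp)] -/
theorem _root_.Literature.NumberTheory.EllipticCurves.ZpExtension.IsAnticyclotomic.charLocalLambda_eq_of_under_eq
    [IsGalois ℚ K] {κ : ZpExtension K p} (hκ : κ.IsAnticyclotomic)
    (θ : FramedGaloisRep K (padicCoeffIntegers S) 1)
    (hθ : ∀ (τ : absoluteGaloisGroup ℚ) (σ : absoluteGaloisGroup K), θ (absGaloisOuterConj ℚ K τ σ) = θ σ)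
    {w w' : HeightOneSpectrum (𝓞 K)} (h : w.under (𝓞 ℚ) = w'.under (𝓞 ℚ)) :
    charLocalLambda S κ θ w = charLocalLambda S κ θ w' := by
  obtain ⟨g, rfl⟩ := Automorphic.HeightOneSpectrum.exists_algEquiv_smul_eq (F := ℚ) (E := K) h
  obtain ⟨τ, rfl⟩ := absGaloisQuot_surjective ℚ K g
  exact (hκ.charLocalLambda_smul_of_apply_absGaloisOuterConj S θ (hθ τ) w).symm

/-- The `natCast` form of `charLocalLambda_eq_of_under_eq`: `w, w'` contain the same rational prime
`ℓ`. [cite: KellerYin2024, Lemma 1.1.1 (arXiv:2402.12781v2 TeX L455–462)]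
[cite: CastellaGrossiLeeSkinner2022, proof of Thm. 2.2.2 (eq:Euler-comp)] -/
theorem _root_.Literature.NumberTheory.EllipticCurves.ZpExtension.IsAnticyclotomic.charLocalLambda_eq_of_natCast_mem
    [IsGalois ℚ K] {κ : ZpExtension K p} (hκ : κ.IsAnticyclotomic)
    (θ : FramedGaloisRep K (padicCoeffIntegers S) 1)
    (hθ : ∀ (τ : absoluteGaloisGroup ℚ) (σ : absoluteGaloisGroup K), θ (absGaloisOuterConj ℚ K τ σ) = θ σ)
    {ℓ : ℕ} (hℓ : ℓ.Prime) {w w' : HeightOneSpectrum (𝓞 K)} (hw : ((ℓ : ℕ) : 𝓞 K) ∈ w.asIdeal)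
    (hw' : ((ℓ : ℕ) : 𝓞 K) ∈ w'.asIdeal) :
    charLocalLambda S κ θ w = charLocalLambda S κ θ w' :=
  haveI : Fact ℓ.Prime := ⟨hℓ⟩
  hκ.charLocalLambda_eq_of_under_eq S θ hθ (NumberFields.under_eq_under_of_natCast_mem K hw hw')

/-- `GL₁` is commutative: two elements of `GL (Fin 1) A` commute (`1 × 1` matrices over a
commutative ring). [folklore] -/
private theorem generalLinearGroup_fin_one_mul_comm {A : Type*} [CommRing A] (g h : GL (Fin 1) A) :
    g * h = h * g := by
  apply Units.ext
  ext i j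
  fin_cases i; fin_cases j
  simp only [Units.val_mul, Matrix.mul_apply, Fin.sum_univ_one, Fin.zero_eta, Fin.isValue]
  exact mul_comm _ _

/-- **The restriction to `Γ_K` of a character of `Γ_ℚ` is fixed by the outer action** (rank one:
`θ₀(τ · res σ · τ⁻¹) = θ₀(res σ)` as `GL₁` is commutative) — the intended instance of the
hypothesis `hθ` of §3 (the characters `φ, ψ` of `E[p]^{ss}` for `E/ℚ` are characters of `G_ℚ`,
CGLS §1.1 / KY §1.4). [cite: CastellaGrossiLeeSkinner2022, Thm. 2.2.2 (hypothesis "E[p]^ss = 𝔽_p(φ) ⊕ 𝔽_p(ψ)" over G_ℚ)] -/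
theorem comp_absGaloisRestrict_apply_absGaloisOuterConj [IsGalois ℚ K] {A : Type*} [CommRing A]
    [TopologicalSpace A] (θ₀ : FramedGaloisRep ℚ A 1) (τ : absoluteGaloisGroup ℚ)
    (σ : absoluteGaloisGroup K) :
    (θ₀.comp (absGaloisRestrict ℚ K)) (absGaloisOuterConj ℚ K τ σ) =
      (θ₀.comp (absGaloisRestrict ℚ K)) σ := by
  rw [ContinuousMonoidHom.comp_toFun, ContinuousMonoidHom.comp_toFun,
    absGaloisRestrict_absGaloisOuterConj, map_mul, map_mul, map_inv,
    generalLinearGroup_fin_one_mul_comm (θ₀ τ) (θ₀ (absGaloisRestrict ℚ K σ)), mul_inv_cancel_right]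

end Character

/-! ## §4 `λ(𝒫_{w̄}(f_E)) = λ(𝒫_w(f_E))` for an elliptic curve over `ℚ` -/
section Curve

variable {K : Type} [Field K] [NumberField K]

/-- **The reduced Euler factor of `E_K` (`E/ℚ`, `K` quadratic) is the same at two places above the
same rational prime `ℓ`**: if `w ≠ w'` then `ℓ` splits, `e = f = 1` at both
(`ramificationIdx_eq_one_and_inertiaDeg_eq_one_of_natCast_mem_of_ne`) and `L_w(E_K) = L_ℓ(E) = L_{w'}(E_K)`
by the split case of `WeierstrassCurve.localPolynomialAt_baseChange_quadratic` (Ireland–Rosen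
Prop. 20.5.4(b)). [cite: IrelandRosen1990, Ch. 20 §5 Prop. 20.5.4(b)]
[cite: CastellaGrossiLeeSkinner2022, proof of Thm. 2.2.2 (eq:Euler-comp) (the term λ(𝒫_w(E)))] -/
theorem eulerFactorModP_baseChange_eq_of_natCast_mem (W : WeierstrassCurve ℚ) [W.IsElliptic]
    (hK : Module.finrank ℚ K = 2) (p : ℕ) {ℓ : ℕ} (hℓ : ℓ.Prime) {w w' : HeightOneSpectrum (𝓞 K)}
    (hw : ((ℓ : ℕ) : 𝓞 K) ∈ w.asIdeal) (hw' : ((ℓ : ℕ) : 𝓞 K) ∈ w'.asIdeal) :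
    GreenbergVatsal2000.eulerFactorModP (W.baseChange K) p w =
      GreenbergVatsal2000.eulerFactorModP (W.baseChange K) p w' := by
  by_cases hww : w' = w
  · rw [hww]
  haveI : Fact ℓ.Prime := ⟨hℓ⟩
  have hef := NumberFields.ramificationIdx_eq_one_and_inertiaDeg_eq_one_of_natCast_mem_of_ne K hK hw hw' hww
  have hef' := NumberFields.ramificationIdx_eq_one_and_inertiaDeg_eq_one_of_natCast_mem_of_ne K hK hw' hw
    (Ne.symm hww)
  have hu : w.asIdeal.under (𝓞 ℚ) = (w.under (𝓞 ℚ)).asIdeal := rfl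
  have hu' : w'.asIdeal.under (𝓞 ℚ) = (w.under (𝓞 ℚ)).asIdeal := by
    rw [NumberFields.under_eq_under_of_natCast_mem K hw hw']; rfl
  have h1 := ((W.localPolynomialAt_baseChange_quadratic K hK hu).1 hef.1 hef.2).1
  have h2 := ((W.localPolynomialAt_baseChange_quadratic K hK hu').1 hef'.1 hef'.2).1
  rw [GreenbergVatsal2000.eulerFactorModP, GreenbergVatsal2000.eulerFactorModP, h1, h2]

/-- **`λ(𝒫_{w'}(f_E)) = λ(𝒫_w(f_E))` for `E/ℚ`, an anticyclotomic `κ` and two places of the quadratic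
field `K` above the same `ℓ`**: `[Γ : Γ_w]` (§2) times the multiplicity of `(Nw)⁻¹` as a root of
the reduced Euler factor (same polynomial at `w`, `w'`; `Nw' = Nw` for conjugate places).
[cite: KellerYin2024, §1.5 (arXiv:2402.12781v2 TeX L1337–1341)]
[cite: CastellaGrossiLeeSkinner2022, proof of Thm. 2.2.2 (eq:Euler-comp) (the term λ(𝒫_w(E)))] -/
theorem _root_.Literature.NumberTheory.EllipticCurves.ZpExtension.IsAnticyclotomic.curveLocalLambda_baseChange_eq_of_natCast_mem
    {p : ℕ} [Fact p.Prime] (W : WeierstrassCurve ℚ) [W.IsElliptic] (hK : Module.finrank ℚ K = 2)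
    {κ : ZpExtension K p} (hκ : κ.IsAnticyclotomic) {ℓ : ℕ} (hℓ : ℓ.Prime)
    {w w' : HeightOneSpectrum (𝓞 K)} (hw : ((ℓ : ℕ) : 𝓞 K) ∈ w.asIdeal)
    (hw' : ((ℓ : ℕ) : 𝓞 K) ∈ w'.asIdeal) :
    curveLocalLambda κ (W.baseChange K) w = curveLocalLambda κ (W.baseChange K) w' := by
  haveI : Algebra.IsQuadraticExtension ℚ K := ⟨hK⟩
  haveI : Fact ℓ.Prime := ⟨hℓ⟩
  have hu := NumberFields.under_eq_under_of_natCast_mem K hw hw'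
  obtain ⟨g, rfl⟩ := Automorphic.HeightOneSpectrum.exists_algEquiv_smul_eq (F := ℚ) (E := K) hu
  rw [curveLocalLambda_eq, curveLocalLambda_eq, hκ.numPlacesAbove_algEquiv_smul g w,
    eulerFactorModP_baseChange_eq_of_natCast_mem W hK p hℓ hw hw',
    Automorphic.HeightOneSpectrum.absNorm_algEquiv_smul]

end Curve

end Literature.NumberTheory.EllipticCurves.KellerYin2024

end
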